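import Summits.BirchSwinnertonDyer.Rank1Residual.Additive.RamifiedTwistKodairaSymbol
import Literature.NumberTheory.EllipticCurves.NeronComponentIndexTypeI0starProofs
import Literature.NumberTheory.EllipticCurves.NeronComponentIndexTypeInstarProofs
import Literature.NumberTheory.EllipticCurves.TamagawaPrimesEquivProofs
import Literature.NumberTheory.EllipticCurves.LFunctionPrimeCoeff
import Literature.NumberTheory.EllipticCurves.LangHeightNonarchEstimate
import Literature.NumberTheory.EllipticCurves.Rank1Residual.Predicates
import HarnessLib

/-!
# `c_p ∈ {1, 2, 4}` and `p ∤ c_p` at an odd prime `p` for the ramified quadratic twist of a `p`-semistable curve (cell `b2b-bsdres`, seat additive-p4, line V9d)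

HONEST FRAMING (cell `b2b-bsdres`, run/shared/lean/b2b/bsd-rank1-residual/, verbatim in every
file): the goal of the cell is to DELETE the COMBINATION-SHAPED residual classes of the
Birch–Swinnerton-Dyer formula for ALL analytic-rank `≤ 1` elliptic curves over `ℚ` — "full BSD
formula for every rank `≤ 1` curve in class `C`" assembled STRICTLY from published theorems — so
that the rank-`≤ 1` remainder becomes exactly the CONSTRUCTION-SHAPED classes, which are TYPED
(missing-input `Prop`s), NOT attempted. This is not "finishing BSD". The additive sub-cell (seats
additive-p1…p4) is a RESEARCH ROUTE on the construction-shaped classes X3/X4; no claim beyond the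
stated classes; the labels of X3/X4 are UNCHANGED.

Theorems only (no definition, no named fact). Consequences of `kodairaSymbolAt_twist_of_semistable`
(`Additive/RamifiedTwistKodairaSymbol.lean`: any equation `W` of the twist `V^{(D)}` of a globally
minimal `V/ℚ`, good or multiplicative at the place `v` over an odd prime `ℓ ∥ D`, has Kodaira type
`Iₙ*` at `v`) and the tree's discharged Step-6/Step-7 index facts
(`localTamagawaNumber_of_kodairaSymbolAt_eq_Istar_zero_holds`: `I₀*` ⇒ `c ∈ {1, 2, 4}`;
`localTamagawaNumber_of_kodairaSymbolAt_eq_Istar_succ_holds`: `Iₙ*`, `n ≥ 1` ⇒ `c ∈ {2, 4}`):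

* `tamagawaNumberAt_twist_of_semistable_mem` — `c_v(W) ∈ {1, 2, 4}` (place-indexed);
* `tamagawaNumberAt_twist_pm_p_mem`, `not_dvd_tamagawaNumberAt_twist_pm_p` — the prime-indexed form
  used by the cell: `W ≅ V^{(±p)}`, `Good V p ∨ Mult V p`, `p` odd ⇒ `c_p(W) ∈ {1, 2, 4}`, hence
  **`p ∤ c_p(W)`** — item V9d of the seat's repair census: it discharges the per-pair hypothesis
  `htam : p ∤ c_p(E)` of the odd V9/V9b assemblies (`X3RankZeroTwistOdd.*`, `X4RankZeroTwistOdd.*`,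
  `X3RankZeroTwist.*_of_odd_prime`), binding only at `p = 3`.

Census check (harvest-2, HOME/b2b-bsdres-harvest-2/census/v9_r6/R6_answer.md (2)): `c_p(E) ∈
{1, 2, 4}` on 454/454 rank-0 V9 rows (`(I₀*, 1)`: 101, `(I₀*, 2)`: 74, `(Iₙ*, 2)`: 181,
`(Iₙ*, 4)`: 98).

References: [SilvermanATAEC1994] IV.9.4 Steps 6–7, Rem. IV.9.3; [SilvermanAEC2009] VII.6 Thm. 6.1.
-/

noncomputable section

open scoped Classical

namespace Summit.BirchSwinnertonDyer.Rank1Residual.Additive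

section Place

open IsDedekindDomain IsDedekindDomain.HeightOneSpectrum NumberField Rat.HeightOneSpectrum WeierstrassCurve
  Literature.NumberTheory.EllipticCurves Literature.NumberTheory.EllipticCurves.Rank1Residual

variable (v : HeightOneSpectrum (𝓞 ℚ))

/-- **`c_v(W) ∈ {1, 2, 4}`** for any equation `W` of the quadratic twist `V^{(D)}` of a globally
minimal `V/ℚ` good or multiplicative at the place `v` over an odd prime `ℓ ∥ D` (Kodaira type
`I₀*`: `c = 1 + #{roots}` ∈ {1, 2, 4}`, Tate's algorithm Step 6; type `Iₙ*`, `n ≥ 1`: `c ∈ {2, 4}`,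
Step 7 — tree discharges `localTamagawaNumber_of_kodairaSymbolAt_eq_Istar_zero_holds`,
`…_Istar_succ_holds`). In particular `c_v(W) ≠ 3`. [cite: SilvermanATAEC1994, IV.9.4 Steps 6–7 (PDF pp. 345–346) with Rem. IV.9.3] -/
theorem tamagawaNumberAt_twist_of_semistable_mem (V : WeierstrassCurve ℚ) [V.IsElliptic]
    [V.IsGloballyMinimal] (hv2 : (primesEquiv v : ℕ) ≠ 2) {D : ℤ} (hD0 : D ≠ 0)
    (h1 : ((primesEquiv v : ℕ) : ℤ) ∣ D) (h2 : ¬ ((primesEquiv v : ℕ) : ℤ) ^ 2 ∣ D)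
    (hV : V.HasGoodReductionAt v ∨ V.HasMultiplicativeReductionAt v)
    {W : WeierstrassCurve ℚ} [W.IsElliptic] (C : VariableChange ℚ)
    (hW : C • V.quadraticTwist (D : ℚ) = W) :
    W.tamagawaNumberAt v = 1 ∨ W.tamagawaNumberAt v = 2 ∨ W.tamagawaNumberAt v = 4 := by
  haveI : Finite (IsLocalRing.ResidueField (v.adicCompletionIntegers ℚ)) :=
    HeightOneSpectrum.finite_residueField_adicCompletionIntegers ℚ v
  haveI : PerfectField (IsLocalRing.ResidueField (v.adicCompletionIntegers ℚ)) :=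
    PerfectField.ofFinite
  obtain ⟨n, hn⟩ := kodairaSymbolAt_twist_of_semistable v V hv2 hD0 h1 h2 hV C hW
  rw [tamagawaNumberAt_def]
  cases n with
  | zero => exact localTamagawaNumber_of_kodairaSymbolAt_eq_Istar_zero_holds v W hn
  | succ n => exact Or.inr (localTamagawaNumber_of_kodairaSymbolAt_eq_Istar_succ_holds v W n hn)

/-! ### Prime-indexed corollaries: the twist by `±p` -/

/-- **`c_p(W) ∈ {1, 2, 4}` for any equation `W ≅ V^{(±p)}`**, `V/ℚ` globally minimal with good or
multiplicative reduction at the odd prime `p` (cell predicates `Good`/`Mult`; `c_p` = the factor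
`tamagawaNumberAt` of the Tamagawa product at the place of `𝓞 ℚ` over `p`): Kodaira type `I₀*` or
`Iₙ*`. [cite: SilvermanATAEC1994, IV.9.4 Steps 6–7 (PDF pp. 345–346) with Rem. IV.9.3] -/
theorem tamagawaNumberAt_twist_pm_p_mem (p : ℕ) [hp : Fact p.Prime] (hp2 : p ≠ 2)
    (V : WeierstrassCurve ℚ) [V.IsElliptic] [V.IsGloballyMinimal]
    (hV : Good V p ∨ Mult V p) {d : ℚ} (hd : d = p ∨ d = -p)
    {W : WeierstrassCurve ℚ} [W.IsElliptic] (C : VariableChange ℚ)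
    (hW : C • V.quadraticTwist d = W) :
    W.tamagawaNumberAt ((primesEquiv (R := 𝓞 ℚ)).symm ⟨p, hp.out⟩) = 1 ∨
      W.tamagawaNumberAt ((primesEquiv (R := 𝓞 ℚ)).symm ⟨p, hp.out⟩) = 2 ∨
      W.tamagawaNumberAt ((primesEquiv (R := 𝓞 ℚ)).symm ⟨p, hp.out⟩) = 4 := by
  set v : HeightOneSpectrum (𝓞 ℚ) := (primesEquiv (R := 𝓞 ℚ)).symm ⟨p, hp.out⟩ with hvdef
  have hv : (primesEquiv v : ℕ) = p := by rw [hvdef, Equiv.apply_symm_apply]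
  -- the twisting parameter as an integer exactly divisible by `p`
  obtain ⟨D, hDd, hD⟩ : ∃ D : ℤ, (D : ℚ) = d ∧ (D = p ∨ D = -p) := by
    rcases hd with rfl | rfl
    · exact ⟨p, by push_cast; rfl, Or.inl rfl⟩
    · exact ⟨-p, by push_cast; rfl, Or.inr rfl⟩
  have hpZ : Prime (p : ℤ) := Nat.prime_iff_prime_int.mp hp.out
  have hD0 : D ≠ 0 := by
    rcases hD with rfl | rfl <;> simp [hp.out.ne_zero]
  have h1 : ((primesEquiv v : ℕ) : ℤ) ∣ D := by
    rw [hv]; rcases hD with rfl | rfl <;> simp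
  have h2 : ¬ ((primesEquiv v : ℕ) : ℤ) ^ 2 ∣ D := by
    rw [hv]
    intro h
    have h' : (p : ℤ) * p ∣ (p : ℤ) * 1 := by
      rcases hD with rfl | rfl
      · simpa [sq] using h
      · simpa [sq] using (dvd_neg.mpr h)
    have := (mul_dvd_mul_iff_left hpZ.ne_zero).mp h'
    exact hpZ.not_unit (isUnit_of_dvd_one this)
  -- the reduction of `V` at the place `v`
  have hV' : V.HasGoodReductionAt v ∨ V.HasMultiplicativeReductionAt v := by
    rcases hV with hg | hm
    · exact Or.inl ((hasGoodReductionAtPrime_primesEquiv_iff_holds V v p hv).mp hg)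
    · exact Or.inr ((hasMultiplicativeReductionAtPrime_primesEquiv_iff_holds V v p hv).mp hm)
  rw [← hDd] at hW
  exact tamagawaNumberAt_twist_of_semistable_mem v V (by rw [hv]; exact hp2) hD0 h1 h2 hV' C hW

/-- **`p ∤ c_p(W)` for `W ≅ V^{(±p)}`, `V` globally minimal and semistable at the odd prime `p`.**
At `p = 3` this is the content (`c_3 ∈ {1, 2, 4}`, never `3`: types `IV`, `IV*` do not occur);
for `p ≥ 5` it is also the bound `c ≤ 4` at an additive prime. Discharges the hypothesis `htam`
of the odd V9/V9b assemblies (`X3RankZeroTwistOdd.*`, `X4RankZeroTwistOdd.*`,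
`X3RankZeroTwist.*_of_odd_prime`). [cite: SilvermanATAEC1994, IV.9.4 Steps 6–7 (PDF pp. 345–346) with Rem. IV.9.3] -/
theorem not_dvd_tamagawaNumberAt_twist_pm_p (p : ℕ) [hp : Fact p.Prime] (hp2 : p ≠ 2)
    (V : WeierstrassCurve ℚ) [V.IsElliptic] [V.IsGloballyMinimal]
    (hV : Good V p ∨ Mult V p) {d : ℚ} (hd : d = p ∨ d = -p)
    {W : WeierstrassCurve ℚ} [W.IsElliptic] (C : VariableChange ℚ)
    (hW : C • V.quadraticTwist d = W) :
    ¬ p ∣ W.tamagawaNumberAt ((primesEquiv (R := 𝓞 ℚ)).symm ⟨p, hp.out⟩) := by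
  have hp2' : ¬ p ∣ 2 := fun h ↦ hp2 ((Nat.prime_dvd_prime_iff_eq hp.out Nat.prime_two).mp h)
  have hp4 : ¬ p ∣ 4 := fun h ↦
    hp2' (((Nat.Prime.dvd_mul hp.out).mp (show p ∣ 2 * 2 by norm_num; exact h)).elim id id)
  have hp1 : ¬ p ∣ 1 := fun h ↦ hp.out.one_lt.ne' (Nat.dvd_one.mp h)
  rcases tamagawaNumberAt_twist_pm_p_mem p hp2 V hV hd C hW with h | h | h <;> rw [h]
  · exact hp1
  · exact hp2'
  · exact hp4

end Place

end Summit.BirchSwinnertonDyer.Rank1Residual.Additive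

end
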